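/-
  Summits/AtomisticToContinuum/Crystallization/Theorems/OverbindingBudgetAffineFarFirstShellDrift.lean

  residual stmt-AtomisticToContinuum-31280 · slot Z `FarAggregatePricing 12 (1/25) (1/2000) (1/(2·10⁷))` · leaf LAB₁′ `ShelteredShellLabelling'`
  (leaf list v14′, critic row 890): ★ DRIFT₁ `LabelDriftBound₁` — the drift bound from FIRST-SHELL fits only — PROVED OUTRIGHT;
  part A2 of the split of g56 file A (482 l > 400) requested by critic row 890.  decomp-a2c lens-4, generations 56–57.
  Imports ONLY part A1 `…OverbindingBudgetAffineFarFirstShellCompanions` (tetrahedral companions + unit-frame bound).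
  0 sorry · 0 axiom · no instance · no notation · no option.
-/
import Summits.AtomisticToContinuum.Crystallization.Theorems.OverbindingBudgetAffineFarFirstShellCompanions


/-! # DRIFT₁: integrating FIRST-SHELL affine fits over a labelled close packing

THE STATEMENT.  `LabelDriftBound₁` is the tree's DRIFT `LabelDriftBound` (…FarMatchingSplit) with the fit hypothesis restricted from
label-radius `2` to label-radius `1`: for every Hägg word `s`, every labelling `π : M → barlowStacking 1 √(2/3) s` (injective, based,
exhaustive below `ρ`) and every family of linear maps `L k` fitting ONLY THE TWELVE TOUCHING LABELS of each interior site
(`‖π k' − π k‖ ≤ 1`) to accuracy `η`, the base fit controls every interior site: `‖y k − y i − L i (π k)‖ ≤ D₀ η (1 + ‖π k‖²)`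
(`D₀ = 400`, `labelDriftBound₁_holds`).  DRIFT₁ ⇒ DRIFT (`labelDriftBound_of_one`, the hypothesis only got weaker), so this file
re-proves the tree's `labelDriftBound_holds` through a strictly stronger lemma; its USE is the radius-`1` re-typing LAB₁′ of the leaf LAB′
(…FarFirstShellLabelling): the labelling engine then owes local fits on first shells only (12 touching labels per site, the sites where the
site's own two-shell frame and the stacking labels coincide) instead of the 54 labels of radius `2`.

THE PROOF (what replaces the radius-`2` step of …FarLabelDrift §2).  There, two touching interior labels `k, k'` were compared through ALL
twelve neighbours `n` of `π k'`, using the fit at `k` towards `n` at label distance `≤ 2`.  Here only COMMON touching neighbours are available,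
and the geometric input is IMPORTED from part A1 `…FarFirstShellCompanions` (the g56 file of record, sha16 25d6986152819196, was split
into A1 = its §1–§2 and this A2 = its §3–§4, byte-identical declarations, to respect the 400-line bound on Theorems files):
* A1 §1 TETRAHEDRAL COMPANIONS (`exists_tetrahedral_companions`, PROVED, 18 cases on Hales's layer shells): every vector `X` of a layer shell
  `layerShell σ σ'` has two shell vectors `W₁, W₂` with `⟪X,W₁⟫ = ⟪X,W₂⟫ = ⟪W₁,W₂⟫ = 2`.
* A1 §2 OPERATOR BOUND FROM A UNIT TETRAHEDRAL FRAME (`norm_map_le_of_unit_frame`, PROVED, coordinate-free): `‖A fᵢ‖ ≤ b ⇒ ‖A w‖ ≤ 3b‖w‖`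
  for three unit vectors `fᵢ` with pairwise inner products `1/2`.
  count) with `‖w‖² = ½Σcᵢ² + ½(Σcᵢ)²`, so `Σ|cᵢ| ≤ 3‖w‖` and `‖A fᵢ‖ ≤ b ⇒ ‖A w‖ ≤ 3b‖w‖`.
* §3 `shell_fit_compare₁` / `norm_map_sub_le_of_adjacent₁`: for touching interior labels `k, k'` the three radius-`1` fits `k' → n`, `k → n`,
  `k → k'` give `‖(L k' − L k) x‖ ≤ 3η` for every shell vector `x` of `π k'` whose endpoint ALSO touches `π k` (`‖x + (π k' − π k)‖ ≤ 1`); if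
  `π k = π k'` all twelve qualify (tree frame bound, `24η`), otherwise `X = π k − π k'` is a shell vector and `X`, `W₁/2`, `W₂/2` (§1) qualify
  and form a unit tetrahedral frame (§2, `9η ≤ 24η`).
* §4 the induction of …FarLabelDrift §3 VERBATIM (descent `exists_closer_neighbour`, invariant `‖L k − L i‖ ≤ 24η(5‖π k‖ + 1)` ∧
  `‖y k − y i − L i(π k)‖ ≤ 400η(1 + ‖π k‖²)`; the telescoping fit `k₁ → k` is at label distance `1`).
HIDDEN-GAUGE / DEGENERATE AUDIT: as DRIFT (η = 0 ⇒ exact propagation along touching edges, fine; `ρ < 2` vacuous; `M = {i}` trivial);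
injectivity of `π` is used only at the base; no chart, no `y`-geometry, no `N`-dependence; the case `π k = π k'` (`k ≠ k'` is not excluded by
the fit hypotheses) is handled, not assumed away.
-/

namespace Summit.AtomisticToContinuum.Crystallization.Theorems.OverbindingBudgetAffineFarSmoothSplit

open scoped BigOperators Classical RealInnerProductSpace
open Literature.MathematicalPhysics.StatisticalMechanics
open Literature.Geometry.DiscreteGeometry (layerSpacing layerSpacing_sq layerSpacing_pos layerShell hexagonSet holeTriple
  mem_layerShell_iff hexagonSet_subset_layerShell mem_holeTriple_iff mem_holeTriple_one_iff frameW_eq norm_sq_fin3 sqrt_three_sq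
  inner_frameU_frameU inner_frameV_frameV inner_frameU_frameV inner_frameV_frameU inner_frameU_frameE inner_frameE_frameU
  inner_frameV_frameE inner_frameE_frameV inner_frameE_frameE inner_frameW_frameU inner_frameU_frameW inner_frameW_frameV
  inner_frameV_frameW inner_frameW_frameW inner_frameW_frameE inner_frameE_frameW)

/-! ## §3  Comparing two first-shell fits at touching labels (PROVED) -/

/-- **THREE FIRST-SHELL FITS ON A COMMON NEIGHBOUR (PROVED).** For interior labels `k, k'` at label distance `≤ 1` and a shell vector `x`
of the site `π k'` whose endpoint `π k' + x` also touches (or is) `π k` — `‖x + (π k' − π k)‖ ≤ 1` — the three fits `k' → n`, `k → n`,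
`k → k'` ON LABEL RADIUS `1` give `‖L k' x − L k x‖ ≤ 3η`. [this file] -/
theorem shell_fit_compare₁ {s : ℤ → ℤ} (hs : IsHaggSeq s) {N : ℕ} {y π : Fin N → EuclideanSpace ℝ (Fin 3)}
    {M : Finset (Fin N)} {ρ η : ℝ} {L : Fin N → (EuclideanSpace ℝ (Fin 3) →ₗ[ℝ] EuclideanSpace ℝ (Fin 3))}
    (hsurj : ∀ p ∈ barlowStacking 1 (Real.sqrt (2 / 3)) s, ‖p‖ ≤ ρ → ∃ k ∈ M, π k = p)
    (hfit : ∀ k ∈ M, ‖π k‖ + 2 ≤ ρ → ∀ k' ∈ M, ‖π k' - π k‖ ≤ 1 → ‖y k' - y k - L k (π k' - π k)‖ ≤ η)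
    {k k' : Fin N} (hk : k ∈ M) (hk' : k' ∈ M) (hkρ : ‖π k‖ + 2 ≤ ρ) (hk'ρ : ‖π k'‖ + 2 ≤ ρ)
    (hkk' : ‖π k' - π k‖ ≤ 1) {m a b : ℤ} (hp : π k' = barlowPos 1 (Real.sqrt (2 / 3)) s m a b)
    {x : EuclideanSpace ℝ (Fin 3)} (hx : x ∈ barlowShell ((s m : ℤ) : ℝ) (-((s (m - 1) : ℤ) : ℝ)))
    (hxk : ‖x + (π k' - π k)‖ ≤ 1) :
    ‖L k' x - L k x‖ ≤ 3 * η := by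
  have hmem : π k' + x ∈ {z | z ∈ barlowStacking 1 (Real.sqrt (2 / 3)) s ∧
      dist z (barlowPos 1 (Real.sqrt (2 / 3)) s m a b) = 1} := by
    rw [touching_barlowStacking_eq_image_barlowShell hs m a b, ← hp]
    exact ⟨x, hx, rfl⟩
  obtain ⟨hS, hd⟩ := hmem
  rw [← hp, dist_eq_norm, add_sub_cancel_left] at hd
  obtain ⟨n, hn, hπn⟩ := hsurj _ hS (by linarith [norm_add_le (π k') x])
  have f1 := hfit k' hk' hk'ρ n hn (by rw [hπn, add_sub_cancel_left]; linarith)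
  have f2 := hfit k hk hkρ n hn (by rwa [hπn, show π k' + x - π k = x + (π k' - π k) by abel])
  have f3 := hfit k hk hkρ k' hk' hkk'
  rw [hπn, add_sub_cancel_left] at f1
  have e : L k' x - L k x =
      (y n - y k - L k (π n - π k)) - (y k' - y k - L k (π k' - π k)) - (y n - y k' - L k' x) := by
    rw [hπn, show π k' + x - π k = x + (π k' - π k) by abel, map_add]
    abel
  rw [e]
  calc ‖(y n - y k - L k (π n - π k)) - (y k' - y k - L k (π k' - π k)) - (y n - y k' - L k' x)‖
      ≤ ‖(y n - y k - L k (π n - π k)) - (y k' - y k - L k (π k' - π k))‖ + ‖y n - y k' - L k' x‖ := norm_sub_le _ _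
    _ ≤ ‖y n - y k - L k (π n - π k)‖ + ‖y k' - y k - L k (π k' - π k)‖ + ‖y n - y k' - L k' x‖ := by
        gcongr; exact norm_sub_le _ _
    _ ≤ η + η + η := by gcongr
    _ = 3 * η := by ring

/-- **TOUCHING LABELS HAVE CLOSE FIRST-SHELL FITS (PROVED).** For interior labels `k, k'` with `‖π k' − π k‖ ≤ 1` and fits on label
radius `1` only: `‖L k' w − L k w‖ ≤ 24 η ‖w‖` for all `w`.  If `π k = π k'` every shell vector of `π k'` qualifies for
`shell_fit_compare₁` and the tree's frame bound `norm_map_le_of_frame` applies; otherwise `X = π k − π k'` is a shell vector, its two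
tetrahedral companions (§1) are common touching neighbours, and `{X, W₁/2, W₂/2}` is a unit tetrahedral frame (§2). [this file] -/
theorem norm_map_sub_le_of_adjacent₁ {s : ℤ → ℤ} (hs : IsHaggSeq s) {N : ℕ} {y π : Fin N → EuclideanSpace ℝ (Fin 3)}
    {M : Finset (Fin N)} {ρ η : ℝ} {L : Fin N → (EuclideanSpace ℝ (Fin 3) →ₗ[ℝ] EuclideanSpace ℝ (Fin 3))}
    (hbar : ∀ k ∈ M, π k ∈ barlowStacking 1 (Real.sqrt (2 / 3)) s ∧ ‖π k‖ ≤ ρ)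
    (hsurj : ∀ p ∈ barlowStacking 1 (Real.sqrt (2 / 3)) s, ‖p‖ ≤ ρ → ∃ k ∈ M, π k = p)
    (hfit : ∀ k ∈ M, ‖π k‖ + 2 ≤ ρ → ∀ k' ∈ M, ‖π k' - π k‖ ≤ 1 → ‖y k' - y k - L k (π k' - π k)‖ ≤ η)
    {k k' : Fin N} (hk : k ∈ M) (hk' : k' ∈ M) (hkρ : ‖π k‖ + 2 ≤ ρ) (hk'ρ : ‖π k'‖ + 2 ≤ ρ)
    (hkk' : ‖π k' - π k‖ ≤ 1) (w : EuclideanSpace ℝ (Fin 3)) :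
    ‖L k' w - L k w‖ ≤ 24 * η * ‖w‖ := by
  obtain ⟨m, a, b, hp⟩ := (hbar k' hk').1
  have hσ : ((s m : ℤ) : ℝ) = 1 ∨ ((s m : ℤ) : ℝ) = -1 := by
    rcases hs m with h | h <;> simp [h]
  have hτ : (-((s (m - 1) : ℤ) : ℝ)) = 1 ∨ (-((s (m - 1) : ℤ) : ℝ)) = -1 := by
    rcases hs (m - 1) with h | h <;> simp [h]
  have hη : 0 ≤ η := le_trans (norm_nonneg _) (hfit k hk hkρ k' hk' hkk')
  have two0 : (2 : ℝ) ≠ 0 := two_ne_zero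
  by_cases heq : π k = π k'
  · -- every shell vector of `π k'` ends at a touching neighbour of `π k = π k'`
    have key : ∀ X : EuclideanSpace ℝ (Fin 3),
        (2 : ℝ)⁻¹ • X ∈ barlowShell ((s m : ℤ) : ℝ) (-((s (m - 1) : ℤ) : ℝ)) → ‖(L k' - L k) X‖ ≤ 6 * η := by
      intro X hX
      have hxk : ‖(2 : ℝ)⁻¹ • X + (π k' - π k)‖ ≤ 1 := by
        rw [heq, sub_self, add_zero, norm_eq_one_of_mem_barlowShell hσ hτ hX]
      have h := shell_fit_compare₁ hs hsurj hfit hk hk' hkρ hk'ρ hkk' hp hX hxk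
      have hX2 : X = (2 : ℝ) • ((2 : ℝ)⁻¹ • X) := by rw [smul_inv_smul₀ two0]
      have e : (L k' - L k) X = (2 : ℝ) • (L k' ((2 : ℝ)⁻¹ • X) - L k ((2 : ℝ)⁻¹ • X)) := by
        conv_lhs => rw [hX2]
        rw [map_smul, LinearMap.sub_apply]
      rw [e, norm_smul, Real.norm_two]
      linarith
    have hxu : (2 : ℝ)⁻¹ • triangularVec₁ (2 : ℝ) ∈ barlowShell ((s m : ℤ) : ℝ) (-((s (m - 1) : ℤ) : ℝ)) := by
      rw [mem_barlowShell_iff, smul_inv_smul₀ two0]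
      exact hexagonSet_subset_layerShell _ _ (by simp [hexagonSet])
    have hxv : (2 : ℝ)⁻¹ • triangularVec₂ (2 : ℝ) ∈ barlowShell ((s m : ℤ) : ℝ) (-((s (m - 1) : ℤ) : ℝ)) := by
      rw [mem_barlowShell_iff, smul_inv_smul₀ two0]
      exact hexagonSet_subset_layerShell _ _ (by simp [hexagonSet])
    have hxe : (2 : ℝ)⁻¹ • (((s m : ℤ) : ℝ) • barlowOffset (2 : ℝ) + layerNormal layerSpacing) ∈
        barlowShell ((s m : ℤ) : ℝ) (-((s (m - 1) : ℤ) : ℝ)) := by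
      rw [mem_barlowShell_iff, smul_inv_smul₀ two0, mem_layerShell_iff]
      exact Or.inr (Or.inl (by simp [holeTriple]))
    have hop := norm_map_le_of_frame (L k' - L k) hσ (key _ hxu) (key _ hxv) (key _ hxe) w
    rw [LinearMap.sub_apply] at hop
    linarith
  · -- `X = π k − π k'` is a shell vector of `π k'`; its tetrahedral companions are common touching neighbours
    have hne : π k ≠ π k' := heq
    have h1 : 1 ≤ dist (π k) (π k') :=
      le_dist_of_mem_barlowStacking_ideal hs one_pos (by rw [Real.sq_sqrt (by norm_num : (0 : ℝ) ≤ 2 / 3)]; norm_num)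
        (hbar k hk).1 (hbar k' hk').1 hne
    have hd1 : dist (π k) (π k') = 1 := le_antisymm (by rwa [dist_eq_norm, ← norm_neg, neg_sub]) h1
    have hmem : π k ∈ {z | z ∈ barlowStacking 1 (Real.sqrt (2 / 3)) s ∧
        dist z (barlowPos 1 (Real.sqrt (2 / 3)) s m a b) = 1} := ⟨(hbar k hk).1, by rw [← hp]; exact hd1⟩
    rw [touching_barlowStacking_eq_image_barlowShell hs m a b, ← hp] at hmem
    obtain ⟨X, hX, hXk⟩ := hmem
    have hXk' : π k' + X = π k := hXk
    have hXdef : X = π k - π k' := eq_sub_of_add_eq' hXk'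
    have hX1 : ‖X‖ = 1 := norm_eq_one_of_mem_barlowShell hσ hτ hX
    obtain ⟨W₁, hW₁, W₂, hW₂, i₁, i₂, i₁₂⟩ := exists_tetrahedral_companions hσ hτ (mem_barlowShell_iff.1 hX)
    have hx₁ : (2 : ℝ)⁻¹ • W₁ ∈ barlowShell ((s m : ℤ) : ℝ) (-((s (m - 1) : ℤ) : ℝ)) := by
      rw [mem_barlowShell_iff, smul_inv_smul₀ two0]; exact hW₁
    have hx₂ : (2 : ℝ)⁻¹ • W₂ ∈ barlowShell ((s m : ℤ) : ℝ) (-((s (m - 1) : ℤ) : ℝ)) := by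
      rw [mem_barlowShell_iff, smul_inv_smul₀ two0]; exact hW₂
    have n₁ : ‖(2 : ℝ)⁻¹ • W₁‖ = 1 := norm_eq_one_of_mem_barlowShell hσ hτ hx₁
    have n₂ : ‖(2 : ℝ)⁻¹ • W₂‖ = 1 := norm_eq_one_of_mem_barlowShell hσ hτ hx₂
    -- the unit frame `X, W₁/2, W₂/2`
    have j₁ : ⟪X, (2 : ℝ)⁻¹ • W₁⟫ = (1 / 2 : ℝ) := by
      rw [real_inner_smul_right]
      rw [real_inner_smul_left] at i₁
      linarith
    have j₂ : ⟪X, (2 : ℝ)⁻¹ • W₂⟫ = (1 / 2 : ℝ) := by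
      rw [real_inner_smul_right]
      rw [real_inner_smul_left] at i₂
      linarith
    have j₁₂ : ⟪(2 : ℝ)⁻¹ • W₁, (2 : ℝ)⁻¹ • W₂⟫ = (1 / 2 : ℝ) := by
      rw [real_inner_smul_left, real_inner_smul_right, i₁₂]; norm_num
    -- the three qualifying shell vectors
    have qX : ‖X + (π k' - π k)‖ ≤ 1 := by rw [hXdef, sub_add_sub_cancel, sub_self, norm_zero]; exact zero_le_one
    have q₁ : ‖(2 : ℝ)⁻¹ • W₁ + (π k' - π k)‖ ≤ 1 := by
      have e : (2 : ℝ)⁻¹ • W₁ + (π k' - π k) = (2 : ℝ)⁻¹ • W₁ - X := by rw [hXdef]; abel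
      have hsq : ‖(2 : ℝ)⁻¹ • W₁ - X‖ ^ 2 = 1 := by
        rw [norm_sub_sq_real, n₁, hX1, real_inner_comm, j₁]; norm_num
      rw [e]
      nlinarith [norm_nonneg ((2 : ℝ)⁻¹ • W₁ - X)]
    have q₂ : ‖(2 : ℝ)⁻¹ • W₂ + (π k' - π k)‖ ≤ 1 := by
      have e : (2 : ℝ)⁻¹ • W₂ + (π k' - π k) = (2 : ℝ)⁻¹ • W₂ - X := by rw [hXdef]; abel
      have hsq : ‖(2 : ℝ)⁻¹ • W₂ - X‖ ^ 2 = 1 := by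
        rw [norm_sub_sq_real, n₂, hX1, real_inner_comm, j₂]; norm_num
      rw [e]
      nlinarith [norm_nonneg ((2 : ℝ)⁻¹ • W₂ - X)]
    have bX := shell_fit_compare₁ hs hsurj hfit hk hk' hkρ hk'ρ hkk' hp hX qX
    have b₁ := shell_fit_compare₁ hs hsurj hfit hk hk' hkρ hk'ρ hkk' hp hx₁ q₁
    have b₂ := shell_fit_compare₁ hs hsurj hfit hk hk' hkρ hk'ρ hkk' hp hx₂ q₂
    have hop := norm_map_le_of_unit_frame (L k' - L k) hX1 n₁ n₂ j₁ j₂ j₁₂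
      (b := 3 * η) (by rw [LinearMap.sub_apply]; exact bX) (by rw [LinearMap.sub_apply]; exact b₁)
      (by rw [LinearMap.sub_apply]; exact b₂) w
    rw [LinearMap.sub_apply] at hop
    nlinarith [norm_nonneg w]

/-! ## §4  ★ DRIFT₁ (PROVED) -/

/-- **DRIFT₁ · `LabelDriftBound₁`** (GENERIC · parameter-free; = the tree's DRIFT `LabelDriftBound` with the fit hypothesis restricted to
LABEL RADIUS `1`): there is an absolute `D₀ ≥ 0` such that for every Hägg word `s`, every configuration `y`, every class `M ∋ i` injectively
labelled by `π` (`π i = 0`) into `barlowStacking 1 √(2/3) s` with `‖π k‖ ≤ ρ` and ONTO the stacking points of norm `≤ ρ`, and every family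
of linear maps `L k` fitting the TOUCHING labels of each interior site (`‖π k‖ + 2 ≤ ρ`, `‖π k' − π k‖ ≤ 1`) to accuracy `η`:
`‖y k − y i − L i (π k)‖ ≤ D₀ η (1 + ‖π k‖²)` at every interior `k`.  PROVED below (`D₀ = 400`). [this file] -/
def LabelDriftBound₁ : Prop :=
  ∃ D₀ : ℝ, 0 ≤ D₀ ∧ ∀ s : ℤ → ℤ, IsHaggSeq s →
    ∀ (N : ℕ) (y : Fin N → EuclideanSpace ℝ (Fin 3)) (i : Fin N) (M : Finset (Fin N))
      (π : Fin N → EuclideanSpace ℝ (Fin 3)) (ρ η : ℝ) (L : Fin N → (EuclideanSpace ℝ (Fin 3) →ₗ[ℝ] EuclideanSpace ℝ (Fin 3))),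
      0 ≤ η → i ∈ M → π i = 0 → Set.InjOn π ↑M →
        (∀ k ∈ M, π k ∈ barlowStacking 1 (Real.sqrt (2 / 3)) s ∧ ‖π k‖ ≤ ρ) →
        (∀ p ∈ barlowStacking 1 (Real.sqrt (2 / 3)) s, ‖p‖ ≤ ρ → ∃ k ∈ M, π k = p) →
        (∀ k ∈ M, ‖π k‖ + 2 ≤ ρ → ∀ k' ∈ M, ‖π k' - π k‖ ≤ 1 → ‖y k' - y k - L k (π k' - π k)‖ ≤ η) →
          ∀ k ∈ M, ‖π k‖ + 2 ≤ ρ → ‖y k - y i - L i (π k)‖ ≤ D₀ * η * (1 + ‖π k‖ ^ 2)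

/-- ★ **DRIFT₁ `LabelDriftBound₁` HOLDS (PROVED, `D₀ = 400`).**  The induction of `labelDriftBound_holds` (…FarLabelDrift §3) verbatim,
with `norm_map_sub_le_of_adjacent₁` (first-shell fits) in place of `norm_map_sub_le_of_adjacent`. [this file] -/
theorem labelDriftBound₁_holds : LabelDriftBound₁ := by
  refine ⟨400, by norm_num, ?_⟩
  intro s hs N y i M π ρ η L hη hi hπi hinj hbar hsurj hfit
  have h0S : (0 : EuclideanSpace ℝ (Fin 3)) ∈ barlowStacking 1 (Real.sqrt (2 / 3)) s := hπi ▸ (hbar i hi).1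
  -- the base label
  have base : ∀ k ∈ M, π k = 0 →
      (∀ w, ‖L k w - L i w‖ ≤ 24 * η * (5 * ‖π k‖ + 1) * ‖w‖) ∧ ‖y k - y i - L i (π k)‖ ≤ 400 * η * (1 + ‖π k‖ ^ 2) := by
    intro k hk hk0
    have hki : k = i := hinj hk hi (by rw [hk0, hπi])
    subst hki
    refine ⟨fun w => ?_, ?_⟩
    · rw [sub_self, norm_zero]
      exact mul_nonneg (mul_nonneg (mul_nonneg (by norm_num) hη) (by positivity)) (norm_nonneg w)
    · rw [hk0, map_zero, sub_self, sub_zero, norm_zero]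
      exact mul_nonneg (mul_nonneg (by norm_num) hη) (by positivity)
  -- induction on `⌈5‖π k‖⌉`
  have P : ∀ n : ℕ, ∀ k ∈ M, ‖π k‖ + 2 ≤ ρ → ‖π k‖ ≤ (n : ℝ) / 5 →
      (∀ w, ‖L k w - L i w‖ ≤ 24 * η * (5 * ‖π k‖ + 1) * ‖w‖) ∧ ‖y k - y i - L i (π k)‖ ≤ 400 * η * (1 + ‖π k‖ ^ 2) := by
    intro n
    induction n with
    | zero =>
      intro k hk hkρ hkn
      have h0 : ‖π k‖ ≤ 0 := by simpa using hkn
      exact base k hk (norm_le_zero_iff.1 h0)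
    | succ n ih =>
      intro k hk hkρ hkn
      by_cases hk0 : π k = 0
      · exact base k hk hk0
      obtain ⟨q, hqS, hdist, hq⟩ := exists_closer_neighbour hs (hbar k hk).1 h0S hk0
      obtain ⟨k₁, hk₁, hπk₁⟩ := hsurj q hqS (by linarith [norm_nonneg q])
      have hk₁ρ : ‖π k₁‖ + 2 ≤ ρ := by rw [hπk₁]; linarith
      have hk₁n : ‖π k₁‖ ≤ (n : ℝ) / 5 := by
        rw [hπk₁]; push_cast at hkn; linarith
      obtain ⟨ih1, ih2⟩ := ih k₁ hk₁ hk₁ρ hk₁n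
      have hd1 : ‖π k - π k₁‖ = 1 := by rw [hπk₁, ← dist_eq_norm, hdist]
      have h1 : 1 ≤ ‖π k‖ := by
        have := le_dist_of_mem_barlowStacking_ideal hs one_pos
          (by rw [Real.sq_sqrt (by norm_num : (0 : ℝ) ≤ 2 / 3)]; norm_num) (hbar k hk).1 h0S hk0
        rwa [dist_zero_right] at this
      have LC := norm_map_sub_le_of_adjacent₁ hs hbar hsurj hfit hk₁ hk hk₁ρ hkρ hd1.le
      refine ⟨fun w => ?_, ?_⟩
      · have hηw : 0 ≤ 24 * η * ‖w‖ := mul_nonneg (mul_nonneg (by norm_num) hη) (norm_nonneg w)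
        have h5 : 5 * ‖π k₁‖ + 2 ≤ 5 * ‖π k‖ + 1 := by rw [hπk₁]; linarith
        calc ‖L k w - L i w‖ ≤ ‖L k w - L k₁ w‖ + ‖L k₁ w - L i w‖ := norm_sub_le_norm_sub_add_norm_sub _ _ _
          _ ≤ 24 * η * ‖w‖ + 24 * η * (5 * ‖π k₁‖ + 1) * ‖w‖ := add_le_add (LC w) (ih1 w)
          _ = 24 * η * ‖w‖ * (5 * ‖π k₁‖ + 2) := by ring
          _ ≤ 24 * η * ‖w‖ * (5 * ‖π k‖ + 1) := mul_le_mul_of_nonneg_left h5 hηw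
          _ = 24 * η * (5 * ‖π k‖ + 1) * ‖w‖ := by ring
      · have T1 := hfit k₁ hk₁ hk₁ρ k hk (by linarith [hd1.le])
        have ih1' := ih1 (π k - π k₁)
        have e : y k - y i - L i (π k) =
            (y k - y k₁ - L k₁ (π k - π k₁)) + (y k₁ - y i - L i (π k₁)) + (L k₁ (π k - π k₁) - L i (π k - π k₁)) := by
          simp only [map_sub]; abel
        rw [e]
        have hq0 := norm_nonneg q
        have hq2 : ‖q‖ ^ 2 ≤ (‖π k‖ - 1 / 5) ^ 2 := pow_le_pow_left₀ hq0 hq 2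
        have key : 1 + 400 * (1 + ‖q‖ ^ 2) + 24 * (5 * ‖q‖ + 1) ≤ 400 * (1 + ‖π k‖ ^ 2) := by
          nlinarith [hq, hq2, h1, hq0]
        have key' := mul_le_mul_of_nonneg_left key hη
        calc ‖(y k - y k₁ - L k₁ (π k - π k₁)) + (y k₁ - y i - L i (π k₁)) + (L k₁ (π k - π k₁) - L i (π k - π k₁))‖
            ≤ ‖(y k - y k₁ - L k₁ (π k - π k₁)) + (y k₁ - y i - L i (π k₁))‖ + ‖L k₁ (π k - π k₁) - L i (π k - π k₁)‖ :=
              norm_add_le _ _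
          _ ≤ ‖y k - y k₁ - L k₁ (π k - π k₁)‖ + ‖y k₁ - y i - L i (π k₁)‖ + ‖L k₁ (π k - π k₁) - L i (π k - π k₁)‖ := by
              gcongr; exact norm_add_le _ _
          _ ≤ η + 400 * η * (1 + ‖π k₁‖ ^ 2) + 24 * η * (5 * ‖π k₁‖ + 1) * ‖π k - π k₁‖ := by gcongr
          _ = η * (1 + 400 * (1 + ‖q‖ ^ 2) + 24 * (5 * ‖q‖ + 1)) := by rw [hd1, hπk₁]; ring
          _ ≤ η * (400 * (1 + ‖π k‖ ^ 2)) := key'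
          _ = 400 * η * (1 + ‖π k‖ ^ 2) := by ring
  intro k hk hkρ
  exact (P ⌈5 * ‖π k‖⌉₊ k hk hkρ (by linarith [Nat.le_ceil (5 * ‖π k‖)])).2

/-- **DRIFT₁ ⇒ DRIFT (PROVED: the fit hypothesis of DRIFT₁ is weaker).**  A second proof of the tree's `labelDriftBound_holds`. [this file] -/
theorem labelDriftBound_of_one (h : LabelDriftBound₁) : LabelDriftBound := by
  obtain ⟨D₀, hD₀, H⟩ := h
  exact ⟨D₀, hD₀, fun s hs N y i M π ρ η L hη hi hπi hinj hbar hsurj hfit =>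
    H s hs N y i M π ρ η L hη hi hπi hinj hbar hsurj
      (fun k hk hkρ k' hk' hkk' => hfit k hk hkρ k' hk' (hkk'.trans one_le_two))⟩

end Summit.AtomisticToContinuum.Crystallization.Theorems.OverbindingBudgetAffineFarSmoothSplit
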